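import Summits.BirchSwinnertonDyer.BirchSwinnertonDyer.Theorems.PrintCf2SplitBadTwoLineDoubleCosetFrame
import Summits.BirchSwinnertonDyer.BirchSwinnertonDyer.Theorems.PrintCf2SplitBadTwoCMPrimaryLocalTypesNamed
import Summits.BirchSwinnertonDyer.BirchSwinnertonDyer.Theorems.PrintCf2SplitBadTwoCMPrimaryDyadicZetaEight
import Summits.BirchSwinnertonDyer.BirchSwinnertonDyer.Theorems.PrintCf2SplitBadTwoCMPrimaryDyadicUnramifiedSqrt
import Summits.BirchSwinnertonDyer.BirchSwinnertonDyer.Theorems.PrintCf2SplitBadTwoETHolds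
import Literature.NumberTheory.EllipticCurves.ZpExtensionInertiaTorsionCyclotomicProofs
import Summits.BirchSwinnertonDyer.BirchSwinnertonDyer.Theorems.PrintCf2SplitBadTwoStrictDatumOfUnrDatum
import HarnessLib

/-!
# Crux `PrintCf2.SplitBadTwoRankOneOfFacts` (stmt-BirchSwinnertonDyer-20368), road α v13, stub S3d — CLASS (i) (`d ≡ 2, 10 (mod 16)`):
# an INERTIAL SIGN-MOVER at `v̄` on `W*`, hence `S_{W*}(K*_∞) ⧸ 𝔖_v̄(K*_∞, W*)` is FINITE

Cell `bsd-print-cf2`, EXTRA WIDTH seat `bsd-line-cf2-p1-w8` g4 (prover-bsd-line-cf2-p1-w8-g4-0); `--supports stmt-BirchSwinnertonDyer-20368`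
(helper, Theses-free). HONEST FRAMING: nothing here closes the crux or a registered stub; BSD is not proved by any of this; no summit
`Statement.lean` is touched; no `sorry`, no new axiom, no Literature fact, no definition.

On a road-α frame (member `C • W = cm7^{(d)}`, `K` imaginary quadratic with `2 = v v̄`, `π² = π − 2`, `r² = r − 2`, `W* = E[𝔮_r^∞]` pinned at `v`,
`κ'` the `ℤ₂`-line unramified outside `v̄`) with `d = 2d'`, `d' ≡ 1 (mod 4)` (i.e. `d ≡ 2, 10 (mod 16)` — -w6 g4's class (i), STATUS
2026-08-29T01:47:57Z), take `σ` in the inertia group of `K_v̄` with cyclotomic character `ε(σ) = −1`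
(`ZpExtension.exists_mem_inertia_cyclotomicCharacter_eq_of_split`). It FIXES `ι√d`: `ε(σ) ≡ 7 (mod 8)` fixes `ι√2` (B15
`smul_geomSqrt_two_eq_of_cyclotomicCharacter`) and inertia fixes `√d'` (`smul_geomSqrt_eq_of_mem_absInertia_of_emod_four_eq_one`), and
`ι√d = ±ι√2·ι√d'`. By the kernel-type local law (R) at `v̄` for `W*` (`endEigenPrimaryTorsion_two_localTypes_named_of_pinned` after the pinning swap)
`σ` acts on `W*[2^k]` as any `N ≡ (+1)·ε(σ) = −1`: so `τ₀ := res σ ∈ I_v̄` acts on `W*` as `−1`, and lies in `ker κ'` by (C3).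
* `exists_inertial_mover_of_frame_classOne` — the mover; * `finite_localDefect_of_frame_classOne` — `Finite (S_{W*}(K*_∞) ⧸ 𝔖)` by part 2's
  (DC-4) `finite_localDefect_of_inertial_mover_of_frame` — the `hQ` of -w3 g11's `StrictDefect.hasCharValuationAt_restricted_of_unr_of_finite`
  (`e_δ = 0` on class (i)); * `strictDefectAtVbar_two_of_frame_classOne` — the S3d body on class (i) with the stub's binders verbatim,
  `(n' : ℤ) = n + 0` (appended 2026-08-29 g4).
[cite: Rubin1999, §3 Lemma 3.6 (ii) and Cor. 3.17] [cite: SerreAbelianLadic1968, Ch. I §1.2] [cite: NeukirchANT1999, Ch. II Prop. (7.12)]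
[cite: GreenbergVatsal2000, §2 pp. 17, 20–21] [cite: Agboola2007, §3 Prop. 3.2]
-/

noncomputable section

set_option linter.dupNamespace false
set_option autoImplicit false

open scoped Classical

open NumberField IsDedekindDomain Field WeierstrassCurve
open Literature.NumberTheory.EllipticCurves Literature.NumberTheory.EllipticCurves.GreenbergSelmer
open Literature.NumberTheory.EllipticCurves.Agboola2007 Literature.NumberTheory.EllipticCurves.GreenbergVatsal2000
open Literature.NumberTheory.GaloisRepresentations
open Summit.BirchSwinnertonDyer.BirchSwinnertonDyer.Theorems.PrintCf2.AdditiveAtSeven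
open Summit.BirchSwinnertonDyer.BirchSwinnertonDyer.Theorems.PrintCf2.CMPrimes
open Summit.BirchSwinnertonDyer.BirchSwinnertonDyer.Theorems.PrintCf2.RestrictedSelmerPair

namespace Summit.BirchSwinnertonDyer.BirchSwinnertonDyer.Theorems.PrintCf2.LineDoubleCoset

variable {K : Type} [Field K] [NumberField K]

/-- **CLASS (i): AN INERTIAL SIGN-MOVER AT `v̄`.** On a road-α frame with `d = 2d'`, `d' ≡ 1 (mod 4)` (`d ≡ 2, 10 (mod 16)`), some `τ₀ ∈ I_v̄` lies in
`Gal(K̄/K*_∞) = ker κ'` and acts on `W* = E[𝔮_r^∞]` (pinned at `v`) as `−1`: the restriction of an inertia element of `K_v̄` of cyclotomic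
character `−1`, which fixes `ι√d = ±ι√2·ι√d'` and therefore, by the kernel-type local law at `v̄`, acts on every `W*[2^k]` as `−1`.
[cite: Rubin1999, §3 Lemma 3.6 (ii) and Cor. 3.17] [cite: SerreAbelianLadic1968, Ch. I §1.2] [cite: NeukirchANT1999, Ch. II Prop. (7.12)] -/
theorem exists_inertial_mover_of_frame_classOne {d' : ℤ} (hd0 : (2 * d' : ℤ) ≠ 0) (hd1 : d' % 4 = 1)
    (W : WeierstrassCurve ℚ) [W.IsElliptic] (C : VariableChange ℚ) (hC : C • W = cm7.quadraticTwist ((2 * d' : ℤ) : ℚ))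
    (hK : IsImaginaryQuadratic K) {v vbar : HeightOneSpectrum (𝓞 K)} (hv : ((2 : ℕ) : 𝓞 K) ∈ v.asIdeal)
    (hvbar : ((2 : ℕ) : 𝓞 K) ∈ vbar.asIdeal) (hne : vbar ≠ v)
    (π : (W.baseChange K).endRing) (hrel : (π : AddMonoid.End (W.baseChange K).geomPoints) * π = π - 2) {r : ℤ_[2]} (hr : r * r = r - 2)
    (hpin : ∀ τ ∈ GreenbergSelmer.inertia v, ∀ x : ↥((W.baseChange K).endEigenPrimaryTorsion 2 π r), τ • x = x ∨ τ • x = -x)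
    (κ' : ZpExtension K 2) (hκ' : κ'.IsUnramifiedOutside vbar) :
    ∃ τ₀ ∈ GreenbergSelmer.inertia vbar, τ₀ ∈ κ'.kerSubgroup ∧
      ∀ x : ↥((W.baseChange K).endEigenPrimaryTorsion 2 π r), τ₀ • x = -x := by
  haveI : Fact (Nat.Prime 2) := ⟨Nat.prime_two⟩
  have hj : W.j = -3375 := j_eq_of_smul_eq_cm7Twist hd0 W C hC
  obtain ⟨θ, hθ⟩ := exists_sq_eq_neg_seven_of_cmEndo_mem_endRing W K hj π hrel
  have hK2 : Module.finrank ℚ K = 2 := hK.1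
  -- (1) an inertia element of `K_v̄` with cyclotomic character `−1`
  have hum1 : IsUnit ((-1 : ℤ) : ℤ_[2]) := by rw [Int.cast_neg, Int.cast_one]; exact isUnit_one.neg
  obtain ⟨τ, hτI, hτχ⟩ := ZpExtension.exists_mem_inertia_cyclotomicCharacter_eq_of_split hK2 hv hvbar hne
    (adicCompletionPrime_mem_primesAbove K vbar) hum1.unit
  rw [inertia_adicCompletionPrime_eq_map_absInertia K vbar, Subgroup.mem_map] at hτI
  obtain ⟨σ, hσI, hστ⟩ := hτI
  set g := absGaloisRestrict K (vbar.adicCompletion K) σ with hg_def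
  have hgτ : g = τ := hστ
  have hε : ((GaloisRep.cyclotomicCharacter K 2 g : ℤ_[2]ˣ) : ℤ_[2]) = -1 := by
    have h1 := congrArg (fun u : ℤ_[2]ˣ ↦ (u : ℤ_[2])) hτχ
    simp only [IsUnit.unit_spec, Int.cast_neg, Int.cast_one] at h1
    rw [hgτ, h1]
  -- (2) `g` fixes `ι√2`, `ι√d'`, hence `ι√d`
  have hA2 : g • absClosureEmbedding ℚ K (WeierstrassCurve.geomSqrt (2 : ℚ)) = absClosureEmbedding ℚ K (WeierstrassCurve.geomSqrt (2 : ℚ)) := by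
    refine (smul_geomSqrt_two_eq_of_cyclotomicCharacter K g).1 (Or.inr ?_)
    rw [hε, map_neg, map_one]
    decide
  have hBd' : g • WeierstrassCurve.geomSqrt ((d' : ℤ) : K) = WeierstrassCurve.geomSqrt ((d' : ℤ) : K) :=
    smul_geomSqrt_eq_of_mem_absInertia_of_emod_four_eq_one vbar hvbar hd1 hσI
  have hAd' : g • absClosureEmbedding ℚ K (WeierstrassCurve.geomSqrt (d' : ℚ)) = absClosureEmbedding ℚ K (WeierstrassCurve.geomSqrt (d' : ℚ)) := by
    -- transport `√d' ∈ K̄` to the `ℚ̄`-image currency: `A' = ±B`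
    set A' := absClosureEmbedding ℚ K (WeierstrassCurve.geomSqrt (d' : ℚ)) with hA'
    set B := WeierstrassCurve.geomSqrt ((d' : ℤ) : K) with hB
    have hsq : A' ^ 2 = B ^ 2 := by
      rw [hA', hB, ← map_pow, WeierstrassCurve.geomSqrt_sq, WeierstrassCurve.geomSqrt_sq, AlgHom.commutes]
      simp only [map_intCast]
    rcases sq_eq_sq_iff_eq_or_eq_neg.mp hsq with hAB | hAB
    · rw [hAB, hBd']
    · rw [hAB, smul_neg, hBd']
  have hAd : g • absClosureEmbedding ℚ K (WeierstrassCurve.geomSqrt (((2 * d' : ℤ)) : ℚ)) =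
      absClosureEmbedding ℚ K (WeierstrassCurve.geomSqrt (((2 * d' : ℤ)) : ℚ)) := by
    set A2 := absClosureEmbedding ℚ K (WeierstrassCurve.geomSqrt (2 : ℚ)) with hA2def
    set A' := absClosureEmbedding ℚ K (WeierstrassCurve.geomSqrt (d' : ℚ)) with hA'
    set Ad := absClosureEmbedding ℚ K (WeierstrassCurve.geomSqrt (((2 * d' : ℤ)) : ℚ)) with hAd_def
    have hsq : Ad ^ 2 = (A2 * A') ^ 2 := by
      rw [hAd_def, hA2def, hA', mul_pow, ← map_pow, ← map_pow, ← map_pow, WeierstrassCurve.geomSqrt_sq, WeierstrassCurve.geomSqrt_sq,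
        WeierstrassCurve.geomSqrt_sq, ← map_mul]
      congr 1
      push_cast
      rfl
    rcases sq_eq_sq_iff_eq_or_eq_neg.mp hsq with h | h
    · rw [h, smul_mul', hA2, hAd']
    · rw [h, smul_neg, smul_mul', hA2, hAd']
  -- (3) the kernel-type local law (R) at `v̄` for `W* = E[𝔮_r^∞]` (pinned at `v`)
  obtain ⟨hcl', -⟩ := endEigenPrimaryTorsion_two_pinningClause_swap W K hj hK hθ π hrel hr hv hvbar hne hpin
  have hcl'' : ∀ τ ∈ GreenbergSelmer.inertia vbar, ∀ y ∈ (W.baseChange K).endEigenPrimaryTorsion 2 π (1 - r),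
      τ • y = y ∨ τ • y = -y := fun τ hτ y hy ↦ by
    rcases hcl' τ hτ ⟨y, hy⟩ with h | h
    · exact Or.inl (congrArg Subtype.val h)
    · exact Or.inr (congrArg Subtype.val h)
  have h1r : (1 - r) * (1 - r) = (1 - r) - 2 := by linear_combination hr
  have hdQ : (((2 * d' : ℤ)) : ℚ) ≠ 0 := by exact_mod_cast hd0
  obtain ⟨α, hα, -, hUR⟩ := endEigenPrimaryTorsion_two_localTypes_named_of_pinned W K hj hθ π hrel h1r hdQ C hC vbar hvbar
    (inertiaDeg_eq_one_of_ne_two K hK2 hvbar hv hne.symm) hcl''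
  simp only [sub_sub_cancel] at hUR
  have hσ0 : IsFrobPow σ ((0 : ℕ) : ℤ) := by exact_mod_cast isFrobPow_zero_iff_mem_absInertia.mpr hσI
  have HR := (hUR σ 0 hσ0 1 (Or.inl ⟨hAd, rfl⟩)).2
  -- (4) `g` acts as `−1` on every level, hence on `W*`
  have hneg : ∀ x : ↥((W.baseChange K).endEigenPrimaryTorsion 2 π r), g • x = -x := by
    intro x
    obtain ⟨k, hk⟩ := exists_pow_smul_endEigenPrimaryTorsion_eq_zero (W.baseChange K) 2 π r x
    have hk' : 2 ^ k • (x : (W.baseChange K).geomPrimaryTorsion 2) = 0 := by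
      have := congrArg Subtype.val hk
      rwa [AddSubmonoidClass.coe_nsmul, ZeroMemClass.coe_zero] at this
    have hmem : (((-1 : ℤ) : ℤ_[2]) - (1 : ℤ) * ((GaloisRep.cyclotomicCharacter K 2 g * (α⁻¹) ^ 0 : ℤ_[2]ˣ) : ℤ_[2])) ∈
        (Ideal.span {(2 : ℤ_[2]) ^ k} : Ideal ℤ_[2]) := by
      rw [pow_zero, mul_one, hε]
      simp
    have hx := HR k (x : (W.baseChange K).geomPrimaryTorsion 2) x.2 hk' (-1) hmem
    apply Subtype.ext
    rw [endEigenPrimaryTorsion.coe_smul, NegMemClass.coe_neg, ← neg_one_zsmul]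
    exact hx
  refine ⟨g, Subgroup.mem_map.mpr ⟨σ, hσI, rfl⟩, ?_, hneg⟩
  exact (mem_kerSubgroup_iff_smul_of_frame hd0 W C hC hK v vbar hv hvbar hne π hrel hr hpin κ' hκ' g).mpr (Or.inr hneg)

/-- **CLASS (i): `Q = S_{W*}(K*_∞) ⧸ 𝔖_v̄(K*_∞, W*)` IS FINITE on every road-α frame with `d = 2d'`, `d' ≡ 1 (mod 4)`** (`d ≡ 2, 10 (mod 16)`) —
part 2's (DC-4) `finite_localDefect_of_inertial_mover_of_frame` fed with the inertial sign-mover; the `hQ` of -w3 g11's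
`StrictDefect.hasCharValuationAt_restricted_of_unr_of_finite`, i.e. `e_δ = 0` on class (i). [cite: GreenbergVatsal2000, §2 pp. 17, 20–21]
[cite: Agboola2007, §3 Prop. 3.2] [cite: Rubin1999, §3 Lemma 3.6 (ii)] -/
theorem finite_localDefect_of_frame_classOne {d' : ℤ} (hd0 : (2 * d' : ℤ) ≠ 0) (hd1 : d' % 4 = 1)
    (W : WeierstrassCurve ℚ) [W.IsElliptic] (C : VariableChange ℚ) (hC : C • W = cm7.quadraticTwist ((2 * d' : ℤ) : ℚ))
    (hK : IsImaginaryQuadratic K) {v vbar : HeightOneSpectrum (𝓞 K)} (hv : ((2 : ℕ) : 𝓞 K) ∈ v.asIdeal)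
    (hvbar : ((2 : ℕ) : 𝓞 K) ∈ vbar.asIdeal) (hne : vbar ≠ v)
    (π : (W.baseChange K).endRing) (hrel : (π : AddMonoid.End (W.baseChange K).geomPoints) * π = π - 2) {r : ℤ_[2]} (hr : r * r = r - 2)
    (hpin : ∀ τ ∈ GreenbergSelmer.inertia v, ∀ x : ↥((W.baseChange K).endEigenPrimaryTorsion 2 π r), τ • x = x ∨ τ • x = -x)
    (κ' : ZpExtension K 2) (hκ' : κ'.IsUnramifiedOutside vbar) :
    Finite (↥(KellerYin2024.unrSelmer κ' ↥((W.baseChange K).endEigenPrimaryTorsion 2 π r) vbar ∅) ⧸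
      (restrictedSelmerZp κ' ↥((W.baseChange K).endEigenPrimaryTorsion 2 π r) vbar).addSubgroupOf
        (KellerYin2024.unrSelmer κ' ↥((W.baseChange K).endEigenPrimaryTorsion 2 π r) vbar ∅)) := by
  obtain ⟨τ₀, hτ₀I, hτ₀κ, hτ₀⟩ := exists_inertial_mover_of_frame_classOne hd0 hd1 W C hC hK hv hvbar hne π hrel hr hpin κ' hκ'
  exact finite_localDefect_of_inertial_mover_of_frame hd0 W C hC hK hv hvbar hne π hrel hr κ' hκ' hτ₀I hτ₀κ hτ₀

/-! ## The S3d body on class (i): `e_δ = 0` -/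

/-- **S3d ON CLASS (i) (`d = 2d'`, `d' ≡ 1 (mod 4)`, i.e. `d ≡ 2, 10 (mod 16)`): the body of `stub_strictDefectAtVbar_two` with its binders VERBATIM plus
`h2d : 2 ∣ d`, `hd1 : (d / 2) % 4 = 1`, concluding `∃ D n, Module.Finite Λ D.X ∧ D.HasCharValuationAt n ∧ (n' : ℤ) = n + 0`.** GIVEN a Greenberg–Vatsal
datum `Dnr` of `S_{W*}(K*_∞)` (f.g., torsion, `char = (H')`, `H'(0) ≠ 0`, `ord₂ H'(0) = n'`), -w3 g11's reader
`StrictDefect.hasCharValuationAt_restricted_of_unr_of_finite` with `hQ := finite_localDefect_of_frame_classOne` (the inertial sign-mover kills the local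
defect at `v̄`) gives `D.HasCharValuationAt n'` for the Agboola datum `D` of `𝔖_v̄(K*_∞, W*)` produced by
`StrictDefect.exists_restrictedDualData_of_unr_endEigenPrimaryTorsion`. HONEST: a per-class instance of the registered stub's conclusion (value `e_δ = 0` on
class (i)); it does not close the stub (which quantifies one class function over all classes) nor the crux.
[cite: GreenbergVatsal2000, §2 Cor. 2.3 (pp. 20–21)] [cite: Agboola2007, §3 Prop. 3.2, §4] [cite: Rubin1999, §3 Lemma 3.6 (ii) and Cor. 3.17] -/
theorem strictDefectAtVbar_two_of_frame_classOne
    (d : ℤ) (hd0 : d ≠ 0) (_hsq : Squarefree d) (_hd4 : d % 4 ≠ 1) (h2d : (2 : ℤ) ∣ d) (hd1 : (d / 2) % 4 = 1)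
    (W : WeierstrassCurve ℚ) [W.IsElliptic] [W.IsGloballyMinimal] (C : VariableChange ℚ)
    (hC : C • W = cm7.quadraticTwist (d : ℚ)) (_hrank : W.analyticRank = 1) (_hsha : Finite W.sha)
    (K : Type) [Field K] [NumberField K] (hK : IsImaginaryQuadratic K)
    (v vbar : HeightOneSpectrum (𝓞 K)) (hv : ((2 : ℕ) : 𝓞 K) ∈ v.asIdeal) (hvbar : ((2 : ℕ) : 𝓞 K) ∈ vbar.asIdeal) (hne : vbar ≠ v)
    (π : (W.baseChange K).endRing) (hπ : (π : AddMonoid.End (W.baseChange K).geomPoints) * π = π - 2)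
    (r : ℤ_[2]) (hr : r * r = r - 2)
    (hpin : ∀ τ ∈ GreenbergSelmer.inertia v, ∀ x : ↥((W.baseChange K).endEigenPrimaryTorsion 2 π r), τ • x = x ∨ τ • x = -x)
    (κ' : ZpExtension K 2) (hκ' : κ'.IsUnramifiedOutside vbar) (γ' : absoluteGaloisGroup K) (hγ' : κ'.IsTopGenerator γ')
    (P : W.toAffine.Point) (c₀ : ℕ) (ℓ : ℤ) (_hP : ¬ IsOfFinAddOrder P)
    (_hgen : ∀ R : W.toAffine.Point, ∃ (k : ℤ) (T : W.toAffine.Point), IsOfFinAddOrder T ∧ R = k • P + T)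
    (_hc₀ : c₀ ≠ 0) (_hker : (W.baseChange ℚ_[2]).IsInReductionKernel (c₀ • W.toPadicPoint 2 P))
    (_hlog : ‖(W.baseChange ℚ_[2]).padicLogPoint (c₀ • W.toPadicPoint 2 P) / (c₀ : ℚ_[2])‖ = (2 : ℝ) ^ (-ℓ))
    (Dnr : GreenbergVatsal2000.DatumDualData κ' γ' ↥((W.baseChange K).endEigenPrimaryTorsion 2 π r)
        (Castella2018.AcSelmer.bdpData ↥((W.baseChange K).endEigenPrimaryTorsion 2 π r) 2 vbar) ∅) (n' : ℕ) (H' : IwasawaAlgebra 2)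
    (hfin : Module.Finite (IwasawaAlgebra 2) Dnr.X) (htors : Module.IsTorsion (IwasawaAlgebra 2) Dnr.X)
    (hch : Module.charIdeal (IwasawaAlgebra 2) Dnr.X = Ideal.span {H'}) (hH0 : PowerSeries.constantCoeff H' ≠ 0)
    (hn' : (PowerSeries.constantCoeff H').valuation = n') :
    ∃ (D : Agboola2007.RestrictedDualData κ' ↥((W.baseChange K).endEigenPrimaryTorsion 2 π r) vbar γ') (n : ℕ),
      Module.Finite (IwasawaAlgebra 2) D.X ∧ D.HasCharValuationAt n ∧ (n' : ℤ) = n + 0 := by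
  haveI : Fact (Nat.Prime 2) := ⟨Nat.prime_two⟩
  haveI := hfin
  obtain ⟨d', rfl⟩ := h2d
  have hd1' : d' % 4 = 1 := by rwa [Int.mul_ediv_cancel_left _ two_ne_zero] at hd1
  have hQ := finite_localDefect_of_frame_classOne hd0 hd1' W C hC hK hv hvbar hne π hπ hr hpin κ' hκ'
  obtain ⟨D, -⟩ := StrictDefect.exists_restrictedDualData_of_unr_endEigenPrimaryTorsion (W.baseChange K) π r hγ' Dnr htors hch hH0
  obtain ⟨hfinD, hval⟩ := StrictDefect.hasCharValuationAt_restricted_of_unr_of_finite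
    (RestrictedSelmerPair.exists_pow_smul_endEigenPrimaryTorsion_eq_zero (W.baseChange K) 2 π r)
    (RestrictedSelmerPair.isOpen_stabilizer_endEigenPrimaryTorsion (W.baseChange K) 2 π r) hγ' Dnr htors hch hH0 hQ D
  rw [hn'] at hval
  exact ⟨D, n', hfinD, hval, by rw [add_zero]⟩

/-- **h15 TURNKEY** — `strictDefectAtVbar_two_of_frame_classOne` with the class hypothesis as ONE conjunction `2 ∣ d ∧ (d / 2) % 4 = 1`, i.e. literally the
type of the binder `h15` of -w6 g5's closer `StrictDefect.strictDefectAtVbar_two_of_classes` ('…StrictDefectAssemblyOfClasses.lean'): the S3d body on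
class (i) with defect `0`. [cite: GreenbergVatsal2000, §2 Cor. 2.3 (pp. 20–21)] [cite: Agboola2007, §3 Prop. 3.2] -/
theorem strictDefectAtVbar_two_of_frame_classOne'
    (d : ℤ) (hd0 : d ≠ 0) (hsq : Squarefree d) (hd4 : d % 4 ≠ 1) (hcl : (2 : ℤ) ∣ d ∧ (d / 2) % 4 = 1)
    (W : WeierstrassCurve ℚ) [W.IsElliptic] [W.IsGloballyMinimal] (C : VariableChange ℚ)
    (hC : C • W = cm7.quadraticTwist (d : ℚ)) (hrank : W.analyticRank = 1) (hsha : Finite W.sha)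
    (K : Type) [Field K] [NumberField K] (hK : IsImaginaryQuadratic K)
    (v vbar : HeightOneSpectrum (𝓞 K)) (hv : ((2 : ℕ) : 𝓞 K) ∈ v.asIdeal) (hvbar : ((2 : ℕ) : 𝓞 K) ∈ vbar.asIdeal) (hne : vbar ≠ v)
    (π : (W.baseChange K).endRing) (hπ : (π : AddMonoid.End (W.baseChange K).geomPoints) * π = π - 2)
    (r : ℤ_[2]) (hr : r * r = r - 2)
    (hpin : ∀ τ ∈ GreenbergSelmer.inertia v, ∀ x : ↥((W.baseChange K).endEigenPrimaryTorsion 2 π r), τ • x = x ∨ τ • x = -x)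
    (κ' : ZpExtension K 2) (hκ' : κ'.IsUnramifiedOutside vbar) (γ' : absoluteGaloisGroup K) (hγ' : κ'.IsTopGenerator γ')
    (P : W.toAffine.Point) (c₀ : ℕ) (ℓ : ℤ) (hP : ¬ IsOfFinAddOrder P)
    (hgen : ∀ R : W.toAffine.Point, ∃ (k : ℤ) (T : W.toAffine.Point), IsOfFinAddOrder T ∧ R = k • P + T)
    (hc₀ : c₀ ≠ 0) (hker : (W.baseChange ℚ_[2]).IsInReductionKernel (c₀ • W.toPadicPoint 2 P))
    (hlog : ‖(W.baseChange ℚ_[2]).padicLogPoint (c₀ • W.toPadicPoint 2 P) / (c₀ : ℚ_[2])‖ = (2 : ℝ) ^ (-ℓ))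
    (Dnr : GreenbergVatsal2000.DatumDualData κ' γ' ↥((W.baseChange K).endEigenPrimaryTorsion 2 π r)
        (Castella2018.AcSelmer.bdpData ↥((W.baseChange K).endEigenPrimaryTorsion 2 π r) 2 vbar) ∅) (n' : ℕ) (H' : IwasawaAlgebra 2)
    (hfin : Module.Finite (IwasawaAlgebra 2) Dnr.X) (htors : Module.IsTorsion (IwasawaAlgebra 2) Dnr.X)
    (hch : Module.charIdeal (IwasawaAlgebra 2) Dnr.X = Ideal.span {H'}) (hH0 : PowerSeries.constantCoeff H' ≠ 0)
    (hn' : (PowerSeries.constantCoeff H').valuation = n') :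
    ∃ (D : Agboola2007.RestrictedDualData κ' ↥((W.baseChange K).endEigenPrimaryTorsion 2 π r) vbar γ') (n : ℕ),
      Module.Finite (IwasawaAlgebra 2) D.X ∧ D.HasCharValuationAt n ∧ (n' : ℤ) = n + 0 :=
  strictDefectAtVbar_two_of_frame_classOne d hd0 hsq hd4 hcl.1 hcl.2 W C hC hrank hsha K hK v vbar hv hvbar hne π hπ r hr hpin κ' hκ' γ' hγ'
    P c₀ ℓ hP hgen hc₀ hker hlog Dnr n' H' hfin htors hch hH0 hn'

end Summit.BirchSwinnertonDyer.BirchSwinnertonDyer.Theorems.PrintCf2.LineDoubleCoset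

end
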